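import Summits.HodgeConjecture.HodgeConjecture.Theorems.EndoscopicMiddleDegreeOrthogonalEnvelopedHeckeGraphAnalyticOfStubs
import Summits.HodgeConjecture.HodgeConjecture.Theorems.EndoscopicMiddleDegreeOrthogonalEnvelopedHeckeImageModelAnalytic
import Summits.HodgeConjecture.HodgeConjecture.Theorems.EndoscopicMiddleDegreeOrthogonalEnvelopedUnifHolomorphic
import Summits.HodgeConjecture.HodgeConjecture.Theorems.EndoscopicMiddleDegreeOrthogonalEnvelopedUnifSliceSection
import Summits.HodgeConjecture.HodgeConjecture.Theorems.EndoscopicMiddleDegreeOrthogonalEnvelopedSectionHolomorphicOfInjOn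
import Summits.HodgeConjecture.HodgeConjecture.Theorems.EndoscopicMiddleDegreeOrthogonalEnvelopedGraphOnRegular
import Summits.HodgeConjecture.HodgeConjecture.Theorems.EndoscopicMiddleDegreeOrthogonalEnvelopedRegularPointOfFiniteUnion
import Summits.HodgeConjecture.HodgeConjecture.Theorems.EndoscopicMiddleDegreeOrthogonalEnvelopedHodgeModelProdBiholomorph
import Summits.HodgeConjecture.HodgeConjecture.Theorems.EndoscopicMiddleDegreeOrthogonalEnvelopedSymmHolomorphicOfHomeomorph
import Summits.HodgeConjecture.HodgeConjecture.Theorems.EndoscopicMiddleDegreeOrthogonalEnvelopedProperlyDiscontinuous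
import Summits.HodgeConjecture.HodgeConjecture.Theorems.EndoscopicMiddleDegreeOrthogonalEnvelopedFreeAction
import Summits.HodgeConjecture.HodgeConjecture.Theorems.EndoscopicMiddleDegreeOrthogonalEnvelopedBallTopology
import Summits.HodgeConjecture.HodgeConjecture.Theorems.EndoscopicMiddleDegreeOrthogonalEnvelopedHeckeGraphChow
import Summits.HodgeConjecture.HodgeConjecture.Theorems.EndoscopicMiddleDegreeOrthogonalEnvelopedHeckeGraphChowHodgeType
import Summits.HodgeConjecture.HodgeConjecture.Theorems.EndoscopicMiddleDegreeOrthogonalEnvelopedTransferFundamentalClass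
import Summits.HodgeConjecture.HodgeConjecture.Theorems.EndoscopicMiddleDegreeOrthogonalEnvelopedTopCorrAction
import Summits.HodgeConjecture.HodgeConjecture.Theorems.EndoscopicMiddleDegreeOrthogonalEnvelopedVanishesOffImage

/-!
# Hecke operators of compact ball quotients are actions of ALGEBRAIC self-correspondences — unconditionally
# (S2b closed; crux `EndoscopicMiddleDegree.OrthogonalEnveloped`, stmt-HodgeConjecture-14300, lead seat c3)

The shared CONSTRUCTION stub of every Hecke line of this crux is closed here from the datum alone:

* `stub_heckeGraphAnalytic` (seat c2's REGISTERED stub S2b, byte-identical): for an admissible `g`, the image of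
  the topological Hecke graph `N_g \ 𝔹 → (X ⊗ X)(ℂ)`, `ℓ ↦ (π ℓ, π_g ℓ)`, read in ANY Hodge model of `X ⊗ X`, is
  a closed analytic subset all of whose regular points have codimension `≥ dim X` — the composition
  `stub_heckeGraphAnalyticOfStubs` (p111259) of `stub_heckeImageModelAnalytic` (p111206; from
  `stub_unifHolomorphic` p110764, `stub_unifSliceSection` p110875, `stub_sectionHolomorphicOfInjOn` p110878,
  `stub_graphOnRegular` p110690, `stub_regularPointOfFiniteUnion` p110844) with `stub_hodgeModelProdBiholomorph`
  (p110858) ∘ `stub_symmHolomorphicOfHomeomorph` (p110775), `stub_properlyDiscontinuous` (G1 composition),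
  `stub_freeOfProperlyDiscontinuous` (p107635), `stub_ballLocallyCompactT2` (p107937).
* `heckeGraphAlgebraic`: hence, by seat c2's Chow/GAGA composition `stub_heckeGraphAlgebraicOfInputs` (p107344)
  with the landed `stub_transferFundamentalClass` (p106716), `stub_topCorrAction` (p107091),
  `stub_vanishesOffImage` (p106705): for EVERY `g`, the Hecke operator `T_g` on `H^{2(m+1)}(X(ℂ); ℂ)` is the
  action `P_γ = pr₁₊(pr₂^* · ∪ γ)` of an algebraic class `γ ∈ algebraicClasses (X ⊗ X) (2(m+1))` — the
  statement `heckeGraphAlgebraic` of lines `purity-sorted-hecke-envelope` / `hodge-tate-legible-envelope` /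
  `middle-involution-purity`, formerly derived from the unobtainable `stub_heckePushPull`, now a THEOREM.
* `isOfHodgeType_heckeCorrespondenceAction`: the Hecke operators preserve every Hodge type, GRANTED the named
  fact `Grothendieck1969_supportedClasses_le_hodgeConiveau` only (seat c2's `stub_heckeHodgeTypeOfGraphAlgebraic`,
  p107349).

References: BMM arXiv:1306.1515 Part 2 §1.8 and Thm. 61; Shimura 1971 Ch. 7; Serre GAGA §19 Prop. 13.
-/

noncomputable section

-- The crux-workfile namespace `Summit.<P>.<Sub>.Cruxes.…` repeats `HodgeConjecture` (single-conjunct summit).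
set_option linter.dupNamespace false

namespace Summit.HodgeConjecture.HodgeConjecture.Cruxes.OrthogonalEnveloped.HeckeGraphChow

open scoped Manifold
open CategoryTheory MonoidalCategory CartesianMonoidalCategory
open Literature.AlgebraicGeometry.Motives (SchemeOver ComplexPoints IsSmoothProjective AlgPoints)
open Literature.AlgebraicGeometry.HodgeTheory
open Literature.AlgebraicGeometry.ShimuraVarieties
open Literature.Geometry.Kaehler (IsAnalyticSet regularLocus IsRegularPointOfCodim)
open Summit.HodgeConjecture.HodgeConjecture.Theorems.EndoscopicMiddleDegreeOrthogonalEnvelopedHeckeGraphChow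
  (stub_heckeGraphAlgebraicOfInputs)
open Summit.HodgeConjecture.HodgeConjecture.Theorems.EndoscopicMiddleDegreeOrthogonalEnvelopedHeckeGraphChowHodgeType
  (stub_heckeHodgeTypeOfGraphAlgebraic)

/-- **Stub S2b (`stub_heckeGraphAnalytic`, REGISTERED by seat c2) — the Hecke graph is a closed analytic subset of
`(X ⊗ X)^an` all of whose regular points have codimension `≥ dim X`**, now PROVED: composition of the landed
sub-stubs (module docstring). [cite: BergeronMillsonMoeglin2016Balls, Part 2 §1.8] [cite: Shimura1973, Ch. 7 §7.2] -/
theorem stub_heckeGraphAnalytic :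
    ∀ (m : ℕ) (X : SchemeOver ℂ) (D : UnitaryBallQuotientDatum (2 * (m + 1)) X), 1 ≤ m → m ≤ 2 →
      ∀ (g : GL (Fin (2 * (m + 1) + 1)) D.E) (h : D.IsHeckeAdmissible g)
        (A : HodgeModel (2 * (m + 1) + 2 * (m + 1)) (X ⊗ X)),
        IsAnalyticSet 𝓘(ℂ, A.model)
            (A.toComplexPoints ⁻¹' Set.range (fun ℓ : D.LevelCover (D.heckeLevel g) ↦
              (AlgPoints.prodEquiv (X := X) (Y := X) (L := ℂ)).symm
                (D.levelProj (D.heckeLevel g) ℓ, UnitaryBallQuotientDatum.IsHeckeAdmissible.twist D h ℓ))) ∧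
          ∀ x ∈ regularLocus 𝓘(ℂ, A.model)
              (A.toComplexPoints ⁻¹' Set.range (fun ℓ : D.LevelCover (D.heckeLevel g) ↦
                (AlgPoints.prodEquiv (X := X) (Y := X) (L := ℂ)).symm
                  (D.levelProj (D.heckeLevel g) ℓ, UnitaryBallQuotientDatum.IsHeckeAdmissible.twist D h ℓ))),
            ∀ q : ℕ, IsRegularPointOfCodim 𝓘(ℂ, A.model)
              (A.toComplexPoints ⁻¹' Set.range (fun ℓ : D.LevelCover (D.heckeLevel g) ↦
                (AlgPoints.prodEquiv (X := X) (Y := X) (L := ℂ)).symm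
                  (D.levelProj (D.heckeLevel g) ℓ, UnitaryBallQuotientDatum.IsHeckeAdmissible.twist D h ℓ))) q x →
              2 * (m + 1) ≤ q :=
  stub_heckeGraphAnalyticOfStubs
    (stub_heckeImageModelAnalytic stub_unifHolomorphic stub_unifSliceSection stub_sectionHolomorphicOfInjOn
      stub_graphOnRegular stub_regularPointOfFiniteUnion)
    (stub_hodgeModelProdBiholomorph stub_symmHolomorphicOfHomeomorph)
    stub_properlyDiscontinuous stub_freeOfProperlyDiscontinuous stub_ballLocallyCompactT2

/-- **Hecke operators are actions of algebraic self-correspondences (UNCONDITIONAL).** For `μ` with Poincaré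
duality, `m ∈ {1,2}`, a compact ball quotient datum `D` on `X` and ANY `g ∈ GL_{2m+3}(E)`: `T_g = P_γ` for
some `γ ∈ algebraicClasses (X ⊗ X) (2(m+1))` (`γ = 0` off the admissible locus; for admissible `g` the
Poincaré dual of the pushed-forward transferred fundamental class along the topological Hecke graph, algebraic
by Chow + GAGA since analytically supported in codimension `dim X`).
[cite: BergeronMillsonMoeglin2016Balls, Part 2 §1.8 and Thm. 61] [cite: SerreGAGA1956, §19 Prop. 13] -/
theorem heckeGraphAlgebraic :
    ∀ (μ : OrientationFamily), μ.HasPoincareDuality →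
      ∀ (m : ℕ) (X : SchemeOver ℂ) (D : UnitaryBallQuotientDatum (2 * (m + 1)) X), 1 ≤ m → m ≤ 2 →
        ∀ g : GL (Fin (2 * (m + 1) + 1)) D.E,
          ∃ γ ∈ algebraicClasses (X ⊗ X) (2 * (m + 1)),
            corrAction μ D.isSmoothProjective D.isSmoothProjective
                (rfl : 2 * (m + 1) + 2 * (2 * (m + 1)) = 2 * (m + 1) + 2 * (2 * (m + 1))) γ =
              D.heckeCorrespondenceAction (2 * (m + 1)) g :=
  stub_heckeGraphAlgebraicOfInputs stub_transferFundamentalClass stub_topCorrAction stub_vanishesOffImage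
    stub_heckeGraphAnalytic

/-- **The Hecke operators preserve every Hodge type**, GRANTED Grothendieck's coniveau remark
`Grothendieck1969_supportedClasses_le_hodgeConiveau` (algebraic classes of codimension `s` are of type `(s,s)`).
[cite: BergeronMillsonMoeglin2016Balls, Part 2 §1.8 and Thm. 61] [cite: GrothendieckTopology1969, p. 300] -/
theorem isOfHodgeType_heckeCorrespondenceAction
    (hG : Grothendieck1969_supportedClasses_le_hodgeConiveau) {μ : OrientationFamily}
    (hμ : μ.HasPoincareDuality) {m : ℕ} {X : SchemeOver ℂ} (D : UnitaryBallQuotientDatum (2 * (m + 1)) X)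
    (hm1 : 1 ≤ m) (hm2 : m ≤ 2) (g : GL (Fin (2 * (m + 1) + 1)) D.E) {p q : ℕ}
    {β : complexBetti X (2 * (m + 1))} (hβ : IsOfHodgeType (2 * (m + 1)) X (2 * (m + 1)) p q β) :
    IsOfHodgeType (2 * (m + 1)) X (2 * (m + 1)) p q (D.heckeCorrespondenceAction (2 * (m + 1)) g β) :=
  stub_heckeHodgeTypeOfGraphAlgebraic heckeGraphAlgebraic hG μ hμ m X D hm1 hm2 g p q β hβ

end Summit.HodgeConjecture.HodgeConjecture.Cruxes.OrthogonalEnveloped.HeckeGraphChow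

end
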